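import Summits.AtomisticToContinuum.FouriersLaw.Theses.HonestZwanzig
import Summits.AtomisticToContinuum.FouriersLaw.Theorems.HonestZwanzigOrthogonalOhmRowIdentity

/-!
# HonestZwanzig / OrthogonalOhm — the contact rows of the row identity (line `Sketch`, stub U2 support)

Support file for crux item `stmt-AtomisticToContinuum-12693` (`HonestZwanzig.OrthogonalOhm`, sub-problem
`FouriersLaw`), line `Sketch`, skeleton v4, registered stub `stub_uniformContactResponse` (U2: an `N`-uniform
bound on ANY zero-frequency limit `w_y` of a contact pairing `schur_s(p_y², J)`, `y ∈ {0, N−1}`).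

Nothing `N`-uniform is proved here (U2 itself is `HasBoundedResponse`-level: by the Ward dictionary W5,
`w_0 = T²D_N/γ − γ⁻¹ h_L·a_N`).  What is proved is the exact fixed-`N` bookkeeping that REDUCES U2 to two named
`N`-uniform inputs:

* `contactRow_left` / `contactRow_right` — the two CONTACT ROWS of the landed row identity S2
  (`stub_rowIdentity`, exact at every `s > 0`), solved for the contact pairing:
  `γ·schur_s(p_0², J) = schur_s(j_0, J) − (χG(s)⁻¹Ψ(s))_0` and
  `γ·schur_s(p²_{N−1}, J) = −schur_s(j_{N−2}, J) − (χG(s)⁻¹Ψ(s))_{N−1}`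
  (`Ψ_u(s) = lap_s(e_u, J)`, `χ = Cov(e,e)`; the missing last bond `j_{N−1} ≡ 0` drops out);
* `contact_left_eq` / `contact_right_eq` — their limit form along `s ↓ 0`: any three limits `ρ` (end-bond
  response), `w` (contact pairing), `m` (endpoint component of the "energy shadow" `χG(s)⁻¹Ψ(s)`) satisfy
  `γw = ρ − m`, resp. `γw = −ρ − m`;
* `uniformContactResponse_of_endBond_of_shadow` — CONDITIONAL U2 with `N`-free constants: at each `N`, if the
  two end-bond responses `schur_s(j_0, J)`, `schur_s(j_{N−2}, J)` have limits of modulus `≤ C₁` (existence: stubs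
  F + B; bound: stub U1) and every limit of the two endpoint shadow components has modulus `≤ C₂`, then every
  limit `w` of a contact pairing has `|w| ≤ (C₁ + C₂)/γ`.  So, modulo U1 and fixed-`N` existence, U2 is EXACTLY
  an `N`-uniform bound on `(χ a_N)_0`, `(χ a_N)_{N−1}`, `a_N = G(0)⁻¹lap_0(e, J)` (the one-profile unknown of
  `Cruxes/OrthogonalOhm/WardDictionary.md`, (c)).
-/

noncomputable section

open MeasureTheory Finset Real Set Filter Topology
open Literature.MathematicalPhysics.KineticTheory.HeatConduction

namespace Summit.AtomisticToContinuum.FouriersLaw.Theorems.HonestZwanzig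

namespace OrthogonalOhmLine.UniformContactResponse

/-! ### Bookkeeping: the two contact rows of the row identity, and limits along `s ↓ 0` -/

section Circuit

variable {N : ℕ}

/-- At the left contact `y = 0` the bond combination of the row identity is `σ_y` alone
(`[y = b+1]` never holds). -/
theorem sum_row_left (σ : Fin N → ℝ) (y : Fin N) (hy : y.val = 0) :
    ∑ b : Fin N, ((if b = y then (1 : ℝ) else 0) - (if y.val = b.val + 1 then 1 else 0)) * σ b = σ y := by
  have h : ∀ b : Fin N, ((if b = y then (1 : ℝ) else 0) - (if y.val = b.val + 1 then 1 else 0)) * σ b =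
      if b = y then σ b else 0 := by
    intro b
    rw [if_neg (show ¬ (y.val = b.val + 1) by omega), sub_zero, ite_mul, one_mul, zero_mul]
  simp_rw [h]
  simp

/-- At the right contact `y = N − 1` (`N ≥ 2`), if `σ_y = 0` (the missing last bond) the bond combination of
the row identity is `−σ_{N−2}`. -/
theorem sum_row_right (hN : 2 ≤ N) (σ : Fin N → ℝ) (y : Fin N) (hy : y.val = N - 1) (hσ : σ y = 0) :
    ∑ b : Fin N, ((if b = y then (1 : ℝ) else 0) - (if y.val = b.val + 1 then 1 else 0)) * σ b =
      -σ ⟨N - 2, by omega⟩ := by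
  have h : ∀ b : Fin N, ((if b = y then (1 : ℝ) else 0) - (if y.val = b.val + 1 then 1 else 0)) * σ b =
      (if b = y then σ b else 0) - (if b = ⟨N - 2, by omega⟩ then σ b else 0) := by
    intro b
    have e2 : (if y.val = b.val + 1 then (1 : ℝ) else 0) = if b = ⟨N - 2, by omega⟩ then 1 else 0 := by
      by_cases hb : b = ⟨N - 2, by omega⟩
      · rw [if_pos hb, if_pos (by rw [hb]; show y.val = N - 2 + 1; omega)]
      · have hne : ¬ (y.val = b.val + 1) := fun h' => hb (Fin.ext (by show b.val = N - 2; omega))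
        rw [if_neg hne, if_neg hb]
    simp only [e2, sub_mul, ite_mul, one_mul, zero_mul]
  simp_rw [h]
  rw [Finset.sum_sub_distrib]
  simp [hσ]

/-- The left contact row of the row identity, solved for the contact pairing: from
`Σ_b ([b = y] − [y = b+1]) σ_b − g([y = 0] + [y = N−1]) τ = S` at `y = 0` (`N ≥ 2`), `g τ = σ_y − S`. -/
theorem row_left (hN : 2 ≤ N) (σ : Fin N → ℝ) (τ S g : ℝ) (y : Fin N) (hy : y.val = 0)
    (h : (∑ b : Fin N, ((if b = y then (1 : ℝ) else 0) - (if y.val = b.val + 1 then 1 else 0)) * σ b) +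
      (-(g * ((if y.val = 0 then (1 : ℝ) else 0) + (if y.val = N - 1 then 1 else 0)))) * τ = S) :
    g * τ = σ y - S := by
  rw [sum_row_left σ y hy, if_pos hy, if_neg (show ¬ (y.val = N - 1) by omega)] at h
  linarith

/-- The right contact row of the row identity, solved for the contact pairing: from the same combination at
`y = N − 1` (`N ≥ 2`, `σ_y = 0`), `g τ = −σ_{N−2} − S`. -/
theorem row_right (hN : 2 ≤ N) (σ : Fin N → ℝ) (τ S g : ℝ) (y : Fin N) (hy : y.val = N - 1) (hσ : σ y = 0)
    (h : (∑ b : Fin N, ((if b = y then (1 : ℝ) else 0) - (if y.val = b.val + 1 then 1 else 0)) * σ b) +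
      (-(g * ((if y.val = 0 then (1 : ℝ) else 0) + (if y.val = N - 1 then 1 else 0)))) * τ = S) :
    g * τ = -σ ⟨N - 2, by omega⟩ - S := by
  rw [sum_row_right hN σ y hy hσ, if_neg (show ¬ (y.val = 0) by omega), if_pos hy] at h
  linarith

/-- Limits along `s ↓ 0` of an exact identity `g·τ(s) = σ(s) − M(s)` (`s > 0`): if `σ → ρ` and `τ → w`
then the third term converges, `M → ρ − g w`. -/
theorem tendsto_shadow_of_row {σ τ M : ℝ → ℝ} {g ρ w : ℝ}
    (hrow : ∀ s, 0 < s → g * τ s = σ s - M s)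
    (hσ : Tendsto σ (nhdsWithin (0 : ℝ) (Set.Ioi 0)) (nhds ρ))
    (hτ : Tendsto τ (nhdsWithin (0 : ℝ) (Set.Ioi 0)) (nhds w)) :
    Tendsto M (nhdsWithin (0 : ℝ) (Set.Ioi 0)) (nhds (ρ - g * w)) := by
  have h1 : Tendsto (fun s => σ s - g * τ s) (nhdsWithin (0 : ℝ) (Set.Ioi 0)) (nhds (ρ - g * w)) :=
    hσ.sub (hτ.const_mul g)
  refine h1.congr' ?_
  filter_upwards [self_mem_nhdsWithin] with s hs
  have h2 := hrow s hs
  linarith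

/-- Limits along `s ↓ 0` of an exact identity `g·τ(s) = σ(s) − M(s)` (`s > 0`): any three limits
`σ → ρ`, `τ → w`, `M → m` satisfy `g w = ρ − m` (limits along the proper filter `𝓝[>] 0` are unique). -/
theorem eq_of_row {σ τ M : ℝ → ℝ} {g ρ w m : ℝ}
    (hrow : ∀ s, 0 < s → g * τ s = σ s - M s)
    (hσ : Tendsto σ (nhdsWithin (0 : ℝ) (Set.Ioi 0)) (nhds ρ))
    (hτ : Tendsto τ (nhdsWithin (0 : ℝ) (Set.Ioi 0)) (nhds w))
    (hM : Tendsto M (nhdsWithin (0 : ℝ) (Set.Ioi 0)) (nhds m)) :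
    g * w = ρ - m := by
  have h1 : m = ρ - g * w := tendsto_nhds_unique hM (tendsto_shadow_of_row hrow hσ hτ)
  linarith

/-- Bound bookkeeping: `g w = ρ − m`, `|ρ| ≤ C₁`, `|m| ≤ C₂`, `g > 0` give `|w| ≤ (C₁ + C₂)/g`. -/
theorem abs_le_of_row {g w ρ m C₁ C₂ : ℝ} (hg : 0 < g) (h : g * w = ρ - m) (hρ : |ρ| ≤ C₁)
    (hm : |m| ≤ C₂) : |w| ≤ (C₁ + C₂) / g := by
  rw [le_div_iff₀ hg]
  have h1 : |w| * g = |ρ - m| := by rw [← h, abs_mul, abs_of_pos hg, mul_comm]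
  rw [h1]
  exact (abs_sub ρ m).trans (add_le_add hρ hm)

end Circuit

end OrthogonalOhmLine.UniformContactResponse

/-! ### The contact rows for the canonical objects of the route -/

open OrthogonalOhmLine.UniformContactResponse

/-- **Left contact row** of the row identity S2 (`stub_rowIdentity`), solved for the contact pairing, at fixed
`N ≥ 2` and every `s > 0`: for `y = 0`,
`γ·schur_s(p_y², J) = schur_s(j_y, J) − Σ_x Σ_u cov(e_y, e_x) (G(s)⁻¹)_{xu} lap_s(e_u, J)`. -/
theorem contactRow_left : Summit.AtomisticToContinuum.FouriersLaw.Theses.HonestZwanzig.FeshbachIdentities →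
    ∀ ω₂ lam β γ : ℝ, 0 < ω₂ → 0 < lam → 0 < β → 0 < γ → ∀ T : ℝ, 0 < T → ∀ N : ℕ, 2 ≤ N → let P := Literature.MathematicalPhysics.KineticTheory.HeatConduction.pinnedChain ω₂ lam β γ; let X := Literature.MathematicalPhysics.KineticTheory.HeatConduction.PhaseSpace N; let μ : MeasureTheory.Measure X := P.gibbsMeasure N T; let corr : (X → ℝ) → (X → ℝ) → ℝ → ℝ := fun f g t => (∫ z, f z * (∫ y, g y ∂(P.transitionKernel N T T t.toNNReal z)) ∂μ) - (∫ z, f z ∂μ) * (∫ z, g z ∂μ); let lap : ℝ → (X → ℝ) → (X → ℝ) → ℝ := fun s f g => ∫ t in Set.Ioi (0 : ℝ), Real.exp (-(s * t)) * corr f g t; let cov : (X → ℝ) → (X → ℝ) → ℝ := fun f g => (∫ z, f z * g z ∂μ) - (∫ z, f z ∂μ) * (∫ z, g z ∂μ); let e : Fin N → X → ℝ := fun x z => z.2 x ^ 2 / 2 + P.U (z.1 x) + ∑ j : Fin N, ((if j.val = x.val + 1 then P.V (z.1 j - z.1 x) / 2 else 0) + (if x.val = j.val + 1 then P.V (z.1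 x - z.1 j) / 2 else 0)); let G : ℝ → Matrix (Fin N) (Fin N) ℝ := fun s => Matrix.of fun x y => lap s (e x) (e y); let schur : ℝ → (X → ℝ) → (X → ℝ) → ℝ := fun s f g => lap s f g - ∑ x : Fin N, ∑ y : Fin N, lap s f (e x) * (G s)⁻¹ x y * lap s (e y) g; let J : X → ℝ := fun z => ∑ i : Fin N, P.bondCurrent N i z; ∀ s : ℝ, 0 < s → ∀ y : Fin N, y.val = 0 →
      P.γ * schur s (fun z => z.2 y ^ 2) J =
        schur s (P.bondCurrent N y) J - ∑ x : Fin N, ∑ u : Fin N, cov (e y) (e x) * (G s)⁻¹ x u * lap s (e u) J := by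
  intro hFI ω₂ lam β γ hω hl hβ hγ T hT N hN P X μ corr lap cov e G schur J s hs y hy
  exact row_left hN (fun b => schur s (P.bondCurrent N b) J) _ _ _ y hy
    (stub_rowIdentity hFI ω₂ lam β γ hω hl hβ hγ T hT N hN s hs y)

/-- **Right contact row** of the row identity S2 (`stub_rowIdentity`), solved for the contact pairing, at fixed
`N ≥ 2` and every `s > 0`: for `y = N − 1` (the missing last bond `j_{N−1} ≡ 0` drops out, `pkg_j_last`),
`γ·schur_s(p_y², J) = −schur_s(j_{N−2}, J) − Σ_x Σ_u cov(e_y, e_x) (G(s)⁻¹)_{xu} lap_s(e_u, J)`. -/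
theorem contactRow_right : Summit.AtomisticToContinuum.FouriersLaw.Theses.HonestZwanzig.FeshbachIdentities →
    ∀ ω₂ lam β γ : ℝ, 0 < ω₂ → 0 < lam → 0 < β → 0 < γ → ∀ T : ℝ, 0 < T → ∀ N : ℕ, ∀ hN : 2 ≤ N, let P := Literature.MathematicalPhysics.KineticTheory.HeatConduction.pinnedChain ω₂ lam β γ; let X := Literature.MathematicalPhysics.KineticTheory.HeatConduction.PhaseSpace N; let μ : MeasureTheory.Measure X := P.gibbsMeasure N T; let corr : (X → ℝ) → (X → ℝ) → ℝ → ℝ := fun f g t => (∫ z, f z * (∫ y, g y ∂(P.transitionKernel N T T t.toNNReal z)) ∂μ) - (∫ z, f z ∂μ) * (∫ z, g z ∂μ); let lap : ℝ → (X → ℝ) → (X → ℝ) → ℝ := fun s f g => ∫ t in Set.Ioi (0 : ℝ), Real.exp (-(s * t)) * corr f g t; let cov : (X → ℝ) → (X → ℝ) → ℝ := fun f g => (∫ z, f z * g z ∂μ) - (∫ z, f z ∂μ) * (∫ z, g z ∂μ); let e : Fin N → X → ℝ := fun x z => z.2 x ^ 2 / 2 + P.U (z.1 x) + ∑ j : Fin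 N, ((if j.val = x.val + 1 then P.V (z.1 j - z.1 x) / 2 else 0) + (if x.val = j.val + 1 then P.V (z.1 x - z.1 j) / 2 else 0)); let G : ℝ → Matrix (Fin N) (Fin N) ℝ := fun s => Matrix.of fun x y => lap s (e x) (e y); let schur : ℝ → (X → ℝ) → (X → ℝ) → ℝ := fun s f g => lap s f g - ∑ x : Fin N, ∑ y : Fin N, lap s f (e x) * (G s)⁻¹ x y * lap s (e y) g; let J : X → ℝ := fun z => ∑ i : Fin N, P.bondCurrent N i z; ∀ s : ℝ, 0 < s → ∀ y : Fin N, y.val = N - 1 →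
      P.γ * schur s (fun z => z.2 y ^ 2) J =
        -schur s (P.bondCurrent N ⟨N - 2, by omega⟩) J -
          ∑ x : Fin N, ∑ u : Fin N, cov (e y) (e x) * (G s)⁻¹ x u * lap s (e u) J := by
  intro hFI ω₂ lam β γ hω hl hβ hγ T hT N hN P X μ corr lap cov e G schur J s hs y hy
  have h0 : schur s (P.bondCurrent N y) J = 0 := by
    have hl0 : ∀ g, lap s (P.bondCurrent N y) g = 0 := fun g =>
      NetworkReduction.pkg_j_last (ω₂ := ω₂) (lam := lam) (β := β) (γ := γ) (N := N) (T := T)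
        (corr := corr) (lap := lap) (fun f g t => rfl) (fun s f g => rfl) s y (by omega) g
    show lap s (P.bondCurrent N y) J -
        ∑ x : Fin N, ∑ u : Fin N, lap s (P.bondCurrent N y) (e x) * (G s)⁻¹ x u * lap s (e u) J = 0
    simp [hl0]
  exact row_right hN (fun b => schur s (P.bondCurrent N b) J) _ _ _ y hy h0
    (stub_rowIdentity hFI ω₂ lam β γ hω hl hβ hγ T hT N hN s hs y)

/-- **Limit form of the left contact row** (fixed `N`, `y = 0`): any limits `ρ` of the end-bond response
`schur_s(j_0, J)`, `w` of the contact pairing `schur_s(p_0², J)` and `m` of the endpoint shadow component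
`(χG(s)⁻¹Ψ(s))_0` along `s ↓ 0` satisfy `γ w = ρ − m`. -/
theorem contact_left_eq : Summit.AtomisticToContinuum.FouriersLaw.Theses.HonestZwanzig.FeshbachIdentities →
    ∀ ω₂ lam β γ : ℝ, 0 < ω₂ → 0 < lam → 0 < β → 0 < γ → ∀ T : ℝ, 0 < T → ∀ N : ℕ, 2 ≤ N → let P := Literature.MathematicalPhysics.KineticTheory.HeatConduction.pinnedChain ω₂ lam β γ; let X := Literature.MathematicalPhysics.KineticTheory.HeatConduction.PhaseSpace N; let μ : MeasureTheory.Measure X := P.gibbsMeasure N T; let corr : (X → ℝ) → (X → ℝ) → ℝ → ℝ := fun f g t => (∫ z, f z * (∫ y, g y ∂(P.transitionKernel N T T t.toNNReal z)) ∂μ) - (∫ z, f z ∂μ) * (∫ z, g z ∂μ); let lap : ℝ → (X → ℝ) → (X → ℝ) → ℝ := fun s f g => ∫ t in Set.Ioi (0 : ℝ), Real.exp (-(s * t)) * corr f g t; let cov : (X → ℝ) → (X → ℝ) → ℝ := fun f g => (∫ z, f z * g z ∂μ) - (∫ z, f z ∂μ) * (∫ z, g z ∂μ); let e : Fin N → X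 → ℝ := fun x z => z.2 x ^ 2 / 2 + P.U (z.1 x) + ∑ j : Fin N, ((if j.val = x.val + 1 then P.V (z.1 j - z.1 x) / 2 else 0) + (if x.val = j.val + 1 then P.V (z.1 x - z.1 j) / 2 else 0)); let G : ℝ → Matrix (Fin N) (Fin N) ℝ := fun s => Matrix.of fun x y => lap s (e x) (e y); let schur : ℝ → (X → ℝ) → (X → ℝ) → ℝ := fun s f g => lap s f g - ∑ x : Fin N, ∑ y : Fin N, lap s f (e x) * (G s)⁻¹ x y * lap s (e y) g; let J : X → ℝ := fun z => ∑ i : Fin N, P.bondCurrent N i z; ∀ y : Fin N, y.val = 0 → ∀ ρ w m : ℝ,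
      Filter.Tendsto (fun s => schur s (P.bondCurrent N y) J) (nhdsWithin (0 : ℝ) (Set.Ioi 0)) (nhds ρ) →
      Filter.Tendsto (fun s => schur s (fun z => z.2 y ^ 2) J) (nhdsWithin (0 : ℝ) (Set.Ioi 0)) (nhds w) →
      Filter.Tendsto (fun s => ∑ x : Fin N, ∑ u : Fin N, cov (e y) (e x) * (G s)⁻¹ x u * lap s (e u) J)
        (nhdsWithin (0 : ℝ) (Set.Ioi 0)) (nhds m) →
      P.γ * w = ρ - m := by
  intro hFI ω₂ lam β γ hω hl hβ hγ T hT N hN P X μ corr lap cov e G schur J y hy ρ w m hρ hw hm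
  have hrow : ∀ s, 0 < s → P.γ * schur s (fun z => z.2 y ^ 2) J =
      schur s (P.bondCurrent N y) J - ∑ x : Fin N, ∑ u : Fin N, cov (e y) (e x) * (G s)⁻¹ x u * lap s (e u) J :=
    fun s hs => row_left hN (fun b => schur s (P.bondCurrent N b) J) _ _ _ y hy
      (stub_rowIdentity hFI ω₂ lam β γ hω hl hβ hγ T hT N hN s hs y)
  exact eq_of_row hrow hρ hw hm

/-- **Limit form of the right contact row** (fixed `N`, `y = N − 1`): any limits `ρ` of the end-bond response
`schur_s(j_{N−2}, J)`, `w` of the contact pairing `schur_s(p²_{N−1}, J)` and `m` of the endpoint shadow component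
`(χG(s)⁻¹Ψ(s))_{N−1}` along `s ↓ 0` satisfy `γ w = −ρ − m`. -/
theorem contact_right_eq : Summit.AtomisticToContinuum.FouriersLaw.Theses.HonestZwanzig.FeshbachIdentities →
    ∀ ω₂ lam β γ : ℝ, 0 < ω₂ → 0 < lam → 0 < β → 0 < γ → ∀ T : ℝ, 0 < T → ∀ N : ℕ, ∀ hN : 2 ≤ N, let P := Literature.MathematicalPhysics.KineticTheory.HeatConduction.pinnedChain ω₂ lam β γ; let X := Literature.MathematicalPhysics.KineticTheory.HeatConduction.PhaseSpace N; let μ : MeasureTheory.Measure X := P.gibbsMeasure N T; let corr : (X → ℝ) → (X → ℝ) → ℝ → ℝ := fun f g t => (∫ z, f z * (∫ y, g y ∂(P.transitionKernel N T T t.toNNReal z)) ∂μ) - (∫ z, f z ∂μ) * (∫ z, g z ∂μ); let lap : ℝ → (X → ℝ) → (X → ℝ) → ℝ := fun s f g => ∫ t in Set.Ioi (0 : ℝ), Real.exp (-(s * t)) * corr f g t; let cov : (X → ℝ) → (X → ℝ) → ℝ := fun f g => (∫ z, f z * g z ∂μ) - (∫ z, f z ∂μ) * (∫ z, g z ∂μ);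 let e : Fin N → X → ℝ := fun x z => z.2 x ^ 2 / 2 + P.U (z.1 x) + ∑ j : Fin N, ((if j.val = x.val + 1 then P.V (z.1 j - z.1 x) / 2 else 0) + (if x.val = j.val + 1 then P.V (z.1 x - z.1 j) / 2 else 0)); let G : ℝ → Matrix (Fin N) (Fin N) ℝ := fun s => Matrix.of fun x y => lap s (e x) (e y); let schur : ℝ → (X → ℝ) → (X → ℝ) → ℝ := fun s f g => lap s f g - ∑ x : Fin N, ∑ y : Fin N, lap s f (e x) * (G s)⁻¹ x y * lap s (e y) g; let J : X → ℝ := fun z => ∑ i : Fin N, P.bondCurrent N i z; ∀ y : Fin N, y.val = N - 1 → ∀ ρ w m : ℝ,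
      Filter.Tendsto (fun s => schur s (P.bondCurrent N ⟨N - 2, by omega⟩) J) (nhdsWithin (0 : ℝ) (Set.Ioi 0))
        (nhds ρ) →
      Filter.Tendsto (fun s => schur s (fun z => z.2 y ^ 2) J) (nhdsWithin (0 : ℝ) (Set.Ioi 0)) (nhds w) →
      Filter.Tendsto (fun s => ∑ x : Fin N, ∑ u : Fin N, cov (e y) (e x) * (G s)⁻¹ x u * lap s (e u) J)
        (nhdsWithin (0 : ℝ) (Set.Ioi 0)) (nhds m) →
      P.γ * w = -ρ - m := by
  intro hFI ω₂ lam β γ hω hl hβ hγ T hT N hN P X μ corr lap cov e G schur J y hy ρ w m hρ hw hm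
  have hrow : ∀ s, 0 < s → P.γ * schur s (fun z => z.2 y ^ 2) J =
      -schur s (P.bondCurrent N ⟨N - 2, by omega⟩) J -
        ∑ x : Fin N, ∑ u : Fin N, cov (e y) (e x) * (G s)⁻¹ x u * lap s (e u) J :=
    fun s hs => contactRow_right hFI ω₂ lam β γ hω hl hβ hγ T hT N hN s hs y hy
  exact eq_of_row hrow hρ.neg hw hm

/-- **Conditional U2** (`N`-free constants; the honest reduction of stub `stub_uniformContactResponse`).  At each
`N ≥ 2`: if the two END-BOND responses `schur_s(j_0, J)`, `schur_s(j_{N−2}, J)` have limits along `s ↓ 0` of modulus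
`≤ C₁` (existence: stubs F + B of line `Sketch`; bound: stub U1), and every limit of the two ENDPOINT SHADOW components
`(χG(s)⁻¹Ψ(s))_y`, `y ∈ {0, N−1}` (`Ψ_u(s) = lap_s(e_u, J)`; at `s = 0` this is `(χ a_N)_y`, `a_N = G(0)⁻¹lap_0(e,J)`),
has modulus `≤ C₂`, then every limit `w` of a contact pairing `schur_s(p_y², J)`, `y ∈ {0, N−1}`, satisfies
`|w| ≤ (C₁ + C₂)/γ`.  (From the contact rows: the shadow component converges to `ρ − γw`, resp. `−ρ − γw`.)
The `N`-uniform bound on the endpoint shadow components is NOT proved anywhere (it is `HasBoundedResponse`-level). -/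
theorem uniformContactResponse_of_endBond_of_shadow :
    Summit.AtomisticToContinuum.FouriersLaw.Theses.HonestZwanzig.FeshbachIdentities →
    ∀ ω₂ lam β γ : ℝ, 0 < ω₂ → 0 < lam → 0 < β → 0 < γ → ∀ T : ℝ, 0 < T → ∀ C₁ C₂ : ℝ, ∀ N : ℕ, 2 ≤ N → let P := Literature.MathematicalPhysics.KineticTheory.HeatConduction.pinnedChain ω₂ lam β γ; let X := Literature.MathematicalPhysics.KineticTheory.HeatConduction.PhaseSpace N; let μ : MeasureTheory.Measure X := P.gibbsMeasure N T; let corr : (X → ℝ) → (X → ℝ) → ℝ → ℝ := fun f g t => (∫ z, f z * (∫ y, g y ∂(P.transitionKernel N T T t.toNNReal z)) ∂μ) - (∫ z, f z ∂μ) * (∫ z, g z ∂μ); let lap : ℝ → (X → ℝ) → (X → ℝ) → ℝ := fun s f g => ∫ t in Set.Ioi (0 : ℝ), Real.exp (-(s * t)) * corr f g t; let cov : (X → ℝ) → (X → ℝ) → ℝ := fun f g => (∫ z, f z * g z ∂μ) - (∫ z, f z ∂μ) * (∫ z, g z ∂μ); let e : Fin N → X → ℝ := fun x z => z.2 x ^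 2 / 2 + P.U (z.1 x) + ∑ j : Fin N, ((if j.val = x.val + 1 then P.V (z.1 j - z.1 x) / 2 else 0) + (if x.val = j.val + 1 then P.V (z.1 x - z.1 j) / 2 else 0)); let G : ℝ → Matrix (Fin N) (Fin N) ℝ := fun s => Matrix.of fun x y => lap s (e x) (e y); let schur : ℝ → (X → ℝ) → (X → ℝ) → ℝ := fun s f g => lap s f g - ∑ x : Fin N, ∑ y : Fin N, lap s f (e x) * (G s)⁻¹ x y * lap s (e y) g; let J : X → ℝ := fun z => ∑ i : Fin N, P.bondCurrent N i z;
      (∀ b : Fin N, (b.val = 0 ∨ b.val = N - 2) → b.val + 1 < N → ∃ ρ : ℝ,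
        Filter.Tendsto (fun s => schur s (P.bondCurrent N b) J) (nhdsWithin (0 : ℝ) (Set.Ioi 0)) (nhds ρ) ∧
          |ρ| ≤ C₁) →
      (∀ y : Fin N, (y.val = 0 ∨ y.val = N - 1) → ∀ m : ℝ,
        Filter.Tendsto (fun s => ∑ x : Fin N, ∑ u : Fin N, cov (e y) (e x) * (G s)⁻¹ x u * lap s (e u) J)
          (nhdsWithin (0 : ℝ) (Set.Ioi 0)) (nhds m) → |m| ≤ C₂) →
      ∀ b : Fin N, (b.val = 0 ∨ b.val = N - 1) → ∀ w : ℝ,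
        Filter.Tendsto (fun s => schur s (fun z => z.2 b ^ 2) J) (nhdsWithin (0 : ℝ) (Set.Ioi 0)) (nhds w) →
          |w| ≤ (C₁ + C₂) / γ := by
  intro hFI ω₂ lam β γ hω hl hβ hγ T hT C₁ C₂ N hN P X μ corr lap cov e G schur J hσ hm b hb w hw
  rcases hb with hb | hb
  · -- left contact `b = 0`: the end bond is `b` itself
    obtain ⟨ρ, hρ, hρC⟩ := hσ b (Or.inl hb) (by omega)
    have hrow : ∀ s, 0 < s → P.γ * schur s (fun z => z.2 b ^ 2) J =
        schur s (P.bondCurrent N b) J -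
          ∑ x : Fin N, ∑ u : Fin N, cov (e b) (e x) * (G s)⁻¹ x u * lap s (e u) J :=
      fun s hs => contactRow_left hFI ω₂ lam β γ hω hl hβ hγ T hT N hN s hs b hb
    have hsh := tendsto_shadow_of_row hrow hρ hw
    have hmC : |ρ - P.γ * w| ≤ C₂ := hm b (Or.inl hb) _ hsh
    exact abs_le_of_row (g := P.γ) hγ (by ring) hρC hmC
  · -- right contact `b = N − 1`: the end bond is `N − 2`
    obtain ⟨ρ, hρ, hρC⟩ := hσ ⟨N - 2, by omega⟩ (Or.inr rfl) (by show N - 2 + 1 < N; omega)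
    have hrow : ∀ s, 0 < s → P.γ * schur s (fun z => z.2 b ^ 2) J =
        -schur s (P.bondCurrent N ⟨N - 2, by omega⟩) J -
          ∑ x : Fin N, ∑ u : Fin N, cov (e b) (e x) * (G s)⁻¹ x u * lap s (e u) J :=
      fun s hs => contactRow_right hFI ω₂ lam β γ hω hl hβ hγ T hT N hN s hs b hb
    have hsh := tendsto_shadow_of_row hrow hρ.neg hw
    have hmC : |-ρ - P.γ * w| ≤ C₂ := hm b (Or.inr hb) _ hsh
    have hρC' : |-ρ| ≤ C₁ := by rwa [abs_neg]
    exact abs_le_of_row (g := P.γ) hγ (by ring) hρC' hmC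

end Summit.AtomisticToContinuum.FouriersLaw.Theorems.HonestZwanzig

end
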